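import Mathlib
import Summits.QuantumFields.YangMills.Theses.ThermalRuler

/-!
# Route `ThermalRuler` — item `RulerSoftens` (stmt-QuantumFields-10419)

Glue (real analysis): the thermal ruler bound `ThermalRulerBound`
(`K₂⁴ β ≤ C log(β K₁ / K₂)^a` under strong exponential decay with constants `K₁, K₂`) forces
the strong-decay rates `m_k ∈ (0,1]` (with `K₁ = 4`) along any sequence of couplings
`b_k → ∞` to tend to `0`, for every compact simple Lie group `G`, every faithful lattice
representation `r` and every central element acting in `r` by a scalar `ω ≠ 1`.

Proof: `ConnectedSpace G` and non-commutativity come from `IsSimpleCompactGroup G`; second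
countability from the closed embedding `r.ρ`; `0 < r.N` because a faithful representation of a
non-abelian group cannot be `0`-dimensional.  Then `m_k⁴ b_k ≤ C log(4 b_k / m_k)^a` whenever
`b_k ≥ 2`, and since `log(4x/ε)^a = o(x)`, eventually `m_k < ε`.
-/

namespace Summit.QuantumFields.YangMills.Theorems.ThermalRuler

open Filter Topology Asymptotics

/-- Real-analysis core of the softening argument: for `C > 0`, `ε > 0` and `a : ℕ`,
eventually in `x → ∞` one has `C * log (x * 4 / ε) ^ a < ε ^ 4 * x`. [folklore] -/
theorem eventually_const_mul_log_pow_lt {C ε : ℝ} (hC : 0 < C) (hε : 0 < ε) (a : ℕ) :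
    ∀ᶠ x : ℝ in atTop, C * Real.log (x * 4 / ε) ^ a < ε ^ 4 * x := by
  have hA : (0 : ℝ) < 4 / ε := by positivity
  have h1 : ((fun x : ℝ => Real.log x ^ a) ∘ fun x : ℝ => 4 / ε * x) =o[atTop]
      (id ∘ fun x : ℝ => 4 / ε * x) :=
    Real.isLittleO_pow_log_id_atTop.comp_tendsto (Tendsto.const_mul_atTop hA tendsto_id)
  have hc : (0 : ℝ) < ε ^ 5 / (8 * C) := by positivity
  have hC' : C ≠ 0 := hC.ne'
  have hε' : ε ≠ 0 := hε.ne'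
  filter_upwards [h1.def hc, eventually_gt_atTop (0 : ℝ)] with x hx hx0
  simp only [Function.comp_apply, id_eq] at hx
  have h4 : x * 4 / ε = 4 / ε * x := by ring
  rw [h4]
  have hnorm : ‖4 / ε * x‖ = 4 / ε * x := by
    rw [Real.norm_eq_abs, abs_of_pos (by positivity)]
  rw [hnorm] at hx
  have hpos : 0 < ε ^ 4 * x := by positivity
  calc C * Real.log (4 / ε * x) ^ a ≤ C * ‖Real.log (4 / ε * x) ^ a‖ :=
        mul_le_mul_of_nonneg_left (Real.le_norm_self _) hC.le
    _ ≤ C * (ε ^ 5 / (8 * C) * (4 / ε * x)) := mul_le_mul_of_nonneg_left hx hC.le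
    _ = ε ^ 4 * x / 2 := by field_simp; ring
    _ < ε ^ 4 * x := by linarith

/-- `RulerSoftens` (item stmt-QuantumFields-10419, route ThermalRuler): the thermal ruler bound
implies softening (`m_k → 0`) of the strong-decay rates along `b_k → ∞` for centre-charged
faithful representations of compact simple Lie groups. -/
theorem rulerSoftens_proof : Summit.QuantumFields.YangMills.Theses.ThermalRuler.RulerSoftens := by
  unfold Summit.QuantumFields.YangMills.Theses.ThermalRuler.RulerSoftens
  intro hR G _ _ _ _ hG r z ω hz hω hρz b m hb hk
  haveI : SecondCountableTopology G :=
    (r.continuous.isClosedEmbedding r.injective).isEmbedding.secondCountableTopology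
  haveI : ConnectedSpace G := hG.1.1
  have hN : 0 < r.N := by
    rcases Nat.eq_zero_or_pos r.N with h | h
    · exfalso
      obtain ⟨a, b', hab⟩ := hG.1.2.1
      haveI : IsEmpty (Fin r.N) := by rw [h]; infer_instance
      exact hab (r.injective (Subsingleton.elim _ _))
    · exact h
  letI : MeasurableSpace G := borel G
  haveI : BorelSpace G := ⟨rfl⟩
  obtain ⟨C, a, hC, hbound⟩ := hR G r.N r.ρ z ω hN r.continuous r.mem_unitary hz hω hρz
  have key : ∀ k, 2 ≤ b k → m k ^ 4 * b k ≤ C * Real.log (b k * 4 / m k) ^ a := fun k hk2 =>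
    hbound (b k) 4 (m k) hk2 (by norm_num) (hk k).1 (hk k).2.1 (hk k).2.2
  rw [tendsto_order]
  refine ⟨fun a' ha' => Eventually.of_forall fun k => ha'.trans (hk k).1, fun ε hε => ?_⟩
  have hev := hb.eventually
    ((eventually_const_mul_log_pow_lt hC hε a).and (eventually_ge_atTop (2 : ℝ)))
  filter_upwards [hev] with k hk'
  obtain ⟨hlt, hk2⟩ := hk'
  by_contra hcon
  rw [not_lt] at hcon
  have hm0 : 0 < m k := (hk k).1
  have hm1 : m k ≤ 1 := (hk k).2.1
  have hb0 : 0 < b k := by linarith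
  have h1 : ε ^ 4 * b k ≤ m k ^ 4 * b k :=
    mul_le_mul_of_nonneg_right (pow_le_pow_left₀ hε.le hcon 4) hb0.le
  have h2 : Real.log (b k * 4 / m k) ≤ Real.log (b k * 4 / ε) :=
    Real.log_le_log (by positivity) (div_le_div_of_nonneg_left (by positivity) hε hcon)
  have h3 : 0 ≤ Real.log (b k * 4 / m k) := by
    apply Real.log_nonneg
    rw [le_div_iff₀ hm0]
    nlinarith
  have h4 : C * Real.log (b k * 4 / m k) ^ a ≤ C * Real.log (b k * 4 / ε) ^ a :=
    mul_le_mul_of_nonneg_left (pow_le_pow_left₀ h3 h2 a) hC.le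
  linarith [key k hk2]

end Summit.QuantumFields.YangMills.Theorems.ThermalRuler
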